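import Summits.QuantumFields.YangMills.Theorems.BalabanUVNodesN20CoreEdgeShellDialDeviationTower
import Summits.QuantumFields.YangMills.Theorems.BalabanUVNodesN20HybridClassLawCharacterisation
import Summits.QuantumFields.YangMills.Theorems.BalabanUVNodesN20KeyedRelWeightFraction

/-!
# BalabanUVNodes ∕ N20 (NE7b) — the `hedge`-JOINT COMPANION, module 13Q: A DEVIATION FLOOR AT ANY KEY READING KILLS EVERY DIAL — module 13N's kill (no constant ∕ fraction
# carries the pinned ℓ¹ letters above an unsummable (Dev) floor) EXTENDED from the ℓ¹-optimal-shell road to ALL SIX DIALS of the hybrid binder list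
# `∃ Bad W shA shB Wsh δ, HybridNE7 …` at the pinned carriers, by composing module 13P's «(Dev) ≤ 2·Z·TV at every key reading» with dag-n20-w4's TV radius of a hybrid
# witness (`exists_tvRadius_of_hybridNE7`, p609004); «frequently `s·Z ≤ Dev`» (the `LawSeparated` quantifier shape of `…StubTwoFalseOfLawSeparated`) kills likewise

Cell `pub-ymgap` (HUMAN RULING D-0062 Track A; D-0149 width push), seat `pub-ymgap-dag-n20-w3` (WIDTH SEAT 3 of 3 on NODE n20 = NE7b) gen 7, CLAIM-3 ∕ INTENT-3
(pub-ymgap INBOX).  Filed `--kind proof --supports stmt-QuantumFields-27366 --as helper` (K3⁸ `SpineGivenEndpointR13SepCoPHV`, rev 28∕29, KEY MAP v2 — the K3 crux re-keyed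
through the version slot; skeleton v6 b4e55110ab73e679, stub 2 `stub_expansion13HV` keeps v5's faces `KeyedRelWeight ∕ KeyedShellWeight` and the pin `PinnedAtLive` verbatim;
K3⁷ stmt-QuantumFields-20544 v5 is the aside this lineage's modules 13–13P were keyed to — lineage BY NAME, mis-key rule R463 (4)(a)); COUNT-NEUTRAL.
ADDITIVE — imports this lineage's module 13P `…N20CoreEdgeShellDialDeviationTower` (gen 7: `fibreDev_le_of_classLawTV`, `fibreDevA∕B_record_le_of_classLawTV`) and dag-n20-w4's
`…N20HybridClassLawCharacterisation` (p609004: `exists_tvRadius_of_hybridNE7`); through them modules 13N ∕ 13L ∕ 13K ∕ 13, dag-n20-d's K edition, node U5d's `fiberSum` and the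
tree's SHAPE `T4MatchingAssembly.HybridNE7` BY NAME; modifies nothing.  [III] = [Balaban1988Convergent], [LF-I∕II] = [Balaban1989LargeFieldI∕II], [King1986] = CMP 102.

WHY.  Module 13N's kill says: an unsummable run-A deviation floor `d_K·Z_A < Dev_A(kr)(K, t_K)` at ONE key reading refutes module 13's PINNED ℓ¹ letters for every constant
reading — i.e. closes the ℓ¹-OPTIMAL-SHELL road to stub 2's (N19′, N21) pair.  Could OTHER shells, a bad class, a weight budget, a core radius (the six dials the stub leaves
free or canonical: `Bad, W, shA, shB, Wsh, δ`) still serve the hybrid at the pinned carriers?  No: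
* §1 [folklore] ★★★ `not_exists_hybridNE7_of_unsummable_fibreDev` — non-negative weights with positive totals on the window, an unsummable deviation floor at ANY class map
  `π K` ⇒ `¬ ∃ Bad W shA shB Wsh δ, HybridNE7 l₀ vol T A B Bad W shA shB Wsh δ`.  Proof: a hybrid witness has a summable TV radius `ρ` of the normalised class laws
  (dag-n20-w4's `exists_tvRadius_of_hybridNE7`), the TV letter pays (Dev) at EVERY class map with fraction `2ρ_K` (module 13P `fibreDev_le_of_classLawTV`), so `d ≤ 2ρ` would
  be summable.  ★★ `not_exists_hybridNE7_of_frequently_fibreDev_ge` — the same from the WEAKER-LOOKING floor «`∃ s > 0`, frequently in `K`: `s·Z_A ≤ Dev_A(π K)(K, t)` at some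
  `|t| ≤ l₀`» (the quantifier shape of `LawSeparated` in dag-n20-w5's `…StubTwoFalseOfLawSeparated` p610536 ∕ `…N19NoDialRescuesLawSeparated`), since `ρ_K → 0`.  By module 13P's
  collapse maximality a floor at a FINER key is the STRONGER hypothesis (`Dev(kr) ≤ 2·Dev(collapse) = 2·Z·TV`): the weakest floor is the class-law TV floor at the collapse, where
  this file's kill is p609004 ∕ p610536's, contraposed; the content here is the transport to every key reading and the mass (not law-separation) form of the floor.
* §2 AT THE RECORD (every tuple with core provisos; carriers `(classSet₁₃, weightA₁₃, weightB₁₃)` = the DIAL-FREE carriers of EVERY `crOfRecord₁₃V (jc …) sh` — dag-n20-d's `rfl`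
  lemmas `crOfRecord₁₃VAt_T ∕ _A ∕ _B`): ★★★ `not_exists_hybridNE7_record_of_unsummable_fibreDevA` ∕ `…_of_frequently_fibreDevA_ge` (and the run-B twins) — an unsummable
  (resp. frequently `≥ s·Z`) run-A deviation floor at ANY key reading `kr`, with positive totals on `|t| ≤ 1`, refutes the hybrid binder list at the record's carriers for EVERY
  volume letter `vol`, EVERY bad class, weight budget, shell split, shell budget and core radius — in particular for every value of stub 2's dials `(jc, sh)` and the canonical
  `(W, Wsh, δ)` of `crOfRecord₁₃V`.
LOCATED (for plan g85 ∕ cdisprove ∕ CRIT-1 ∕ the n19 ∕ n20 lanes; said, not decided): the disprover's handle on stub 2 at its pin now has THREE equivalent-strength currencies at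
the collapse — law separation (p610536), unsummable class-law TV (p609004 contraposed), unsummable collapse deviation (13N ∕ here) — and ONE family of STRONGER handles below it:
an unsummable (Dev) floor inside the classes of ANY key reading (e.g. inside the window classes of the (1.80) window), which needs no across-class law comparison at all.  Whether
any of them holds at the record is the two-run physics ((LS) vs law-merge, first-level saturation) — NOT decided here.

HONEST FRAMING.  [folklore] finite-sum ∕ `max` arithmetic and real series over node U5d's `fiberSum` and the tree's SHAPE `HybridNE7`, dag-n20-w4's p609004 and this lineage's
modules BY NAME; count-neutral; proves NO estimate of the programme: the deviation floors are HYPOTHESES on Bałaban's two-run keyed weights — NOT PRINTED, NOT proved, NOT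
refuted, inhabited for no Bałaban family (A2 declared); the theorems say what such a floor would kill, not that it holds.  Nothing of Bałaban's asserted; no `Provisos₁₃CoPH`
inhabitant claimed (K0⁷ OPEN); NE7 ∕ NE7b ∕ NE7c NOT PRINTED ∕ NOT PROVED; N19 ∕ N20 ∕ N21 NOT discharged; K3⁸ ∕ K3⁷ NOT closed, not claimed, no stub refuted (a stub dies only
if a floor is MEASURED at the record — cdisprove's call); v6 ∕ v5 STAND; counts unmoved; no count claim.  One finite `𝕋⁴_{L^K}` programme at fixed `ε = L^{−K}`, Bałaban AS
PRINTED; the YM mass gap (Clay) is NOT proved by any of this — R4 closes the conditional finite-𝕋⁴ rung `BalabanLadder.UV` only; NOT ℝ⁴, NOT continuum, NOT OS.  No `def`, no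
`instance`, no `notation`, no `sorry`, no private decls.  Sources (location only): [King1986] (3.10)–(3.13) pp.656–657; [LF-II] Thm 1 + (0.1) pp.355–356, (1.80) p.384;
[III] (2.18) p.257.
v1.1 (APPEND-ONLY): §3 — on the LIVE-SELECTOR line the two positivity rows of §2 are theorems (E1 ∕ E2 + `schemeZ_pos`, dag-n20-w2's `sum_classSet₁₃_weightA∕B_pos_of_sel`
p600586 BY NAME; one import added), so the record kills read «live line + floor ⇒ no dial».
-/

noncomputable section

open Finset Filter
open scoped BigOperators Topology

namespace Summit.QuantumFields.YangMills.BalabanUVNodes.N20CoreEdgeShellDialDeviationKill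

open Literature.MathematicalPhysics.QuantumFieldTheory.Balaban1983to89
open Literature.MathematicalPhysics.QuantumFieldTheory.Balaban1983to89.T4Continuum
open Literature.MathematicalPhysics.QuantumFieldTheory.Balaban1983to89.Node00
open T4MatchingAssembly (HybridNE7)
open T4HybridMatching (fiberSum)
open Summit.QuantumFields.BalabanUV.T4Continuum.Spine YMDAG.UVSplit
open Summit.QuantumFields.YangMills.BalabanUVNodes.N21KeyedShellWeightShellZero (weightA₁₃_nonneg weightB₁₃_nonneg)
open Summit.QuantumFields.YangMills.BalabanUVNodes.N20CoreEdgeShellDialDeviationTower (fibreDev_le_of_classLawTV)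
open Summit.QuantumFields.YangMills.BalabanUVNodes.N20HybridClassLawCharacterisation (exists_tvRadius_of_hybridNE7)

/-! ## §1 Abstract: a deviation floor at any class map refutes the hybrid binder list for every choice of the six dials -/

section Kill

variable {ι κ : Type*} [DecidableEq ι] [DecidableEq κ] {l₀ vol : ℝ} {T : ℕ → Finset ι} {A B : ℕ → ℝ → ι → ℝ} {π : ℕ → ι → κ}

/-- **★★★ AN UNSUMMABLE DEVIATION FLOOR AT ANY CLASS MAP KILLS EVERY DIAL.**  Non-negative weights `A, B` with positive totals on the window `|t| ≤ l₀`, a class map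
`π K` per step (ANY key reading) and a floor `d ≥ 0`, `Σ d_K = ∞`, with `d_K·Σ_{T K} A(K, t_K) < Dev_A(π K)(K, t_K)` at some `|t_K| ≤ l₀` for every `K` ⇒ there are NO bad
class `Bad`, weight budget `W`, shells `shA, shB`, shell budget `Wsh`, core radius `δ` with `HybridNE7 l₀ vol T A B Bad W shA shB Wsh δ` (a hybrid witness has a summable class-law
TV radius `ρ` — dag-n20-w4 — and the TV letter pays (Dev) at every class map with fraction `2ρ` — module 13P — so `d ≤ 2ρ` would be summable). [folklore] -/
theorem not_exists_hybridNE7_of_unsummable_fibreDev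
    (hA : ∀ (K : ℕ) (t : ℝ), |t| ≤ l₀ → ∀ τ ∈ T K, 0 ≤ A K t τ) (hB : ∀ (K : ℕ) (t : ℝ), |t| ≤ l₀ → ∀ τ ∈ T K, 0 ≤ B K t τ)
    (hZA : ∀ (K : ℕ) (t : ℝ), |t| ≤ l₀ → 0 < ∑ τ ∈ T K, A K t τ) (hZB : ∀ (K : ℕ) (t : ℝ), |t| ≤ l₀ → 0 < ∑ τ ∈ T K, B K t τ)
    {d : ℕ → ℝ} (hd0 : ∀ K, 0 ≤ d K) (hds : ¬ Summable d)
    (hfloor : ∀ K, ∃ t, |t| ≤ l₀ ∧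
      d K * ∑ τ ∈ T K, A K t τ < ∑ τ ∈ T K, max 0 (A K t τ - fiberSum (T K) (π K) (A K t) (π K τ) / fiberSum (T K) (π K) (B K t) (π K τ) * B K t τ)) :
    ¬ ∃ (Bad : ℕ → ℝ → Finset ι) (W : ℕ → ℝ) (shA shB : ℕ → ℝ → ι → ℝ) (Wsh δ : ℕ → ℝ), HybridNE7 l₀ vol T A B Bad W shA shB Wsh δ := by
  rintro ⟨Bad, W, shA, shB, Wsh, δ, h⟩
  obtain ⟨ρ, hρ01, hρs, hρ⟩ := exists_tvRadius_of_hybridNE7 h hZA hZB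
  refine hds (Summable.of_nonneg_of_le hd0 (fun K => ?_) (hρs.mul_left 2))
  obtain ⟨t, ht, hfl⟩ := hfloor K
  have hdev := fibreDev_le_of_classLawTV (T K) (π K) (A K t) (B K t) (hA K t ht) (hB K t ht) (hZA K t ht) (hZB K t ht) (hρ K t ht)
  exact le_of_lt (lt_of_mul_lt_mul_right (hfl.trans_le hdev) (hZA K t ht).le)

/-- **★★ … AND SO DOES A FREQUENT PROPORTIONAL FLOOR** (the `LawSeparated` quantifier shape, in mass): `0 < s` and, for every `K₀`, some `K ≥ K₀` and `|t| ≤ l₀` with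
`s·Σ_{T K} A ≤ Dev_A(π K)(K, t)` ⇒ no choice of the six dials gives `HybridNE7` (the TV radius of a witness tends to `0`, while the floor forces `s ≤ 2ρ_K` frequently). [folklore] -/
theorem not_exists_hybridNE7_of_frequently_fibreDev_ge
    (hA : ∀ (K : ℕ) (t : ℝ), |t| ≤ l₀ → ∀ τ ∈ T K, 0 ≤ A K t τ) (hB : ∀ (K : ℕ) (t : ℝ), |t| ≤ l₀ → ∀ τ ∈ T K, 0 ≤ B K t τ)
    (hZA : ∀ (K : ℕ) (t : ℝ), |t| ≤ l₀ → 0 < ∑ τ ∈ T K, A K t τ) (hZB : ∀ (K : ℕ) (t : ℝ), |t| ≤ l₀ → 0 < ∑ τ ∈ T K, B K t τ)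
    {s : ℝ} (hs : 0 < s)
    (hfloor : ∀ K₀, ∃ K, K₀ ≤ K ∧ ∃ t, |t| ≤ l₀ ∧
      s * ∑ τ ∈ T K, A K t τ ≤ ∑ τ ∈ T K, max 0 (A K t τ - fiberSum (T K) (π K) (A K t) (π K τ) / fiberSum (T K) (π K) (B K t) (π K τ) * B K t τ)) :
    ¬ ∃ (Bad : ℕ → ℝ → Finset ι) (W : ℕ → ℝ) (shA shB : ℕ → ℝ → ι → ℝ) (Wsh δ : ℕ → ℝ), HybridNE7 l₀ vol T A B Bad W shA shB Wsh δ := by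
  rintro ⟨Bad, W, shA, shB, Wsh, δ, h⟩
  obtain ⟨ρ, hρ01, hρs, hρ⟩ := exists_tvRadius_of_hybridNE7 h hZA hZB
  -- the radius is eventually below `s ∕ 2`
  have hev : ∀ᶠ K in atTop, ρ K < s / 2 := (hρs.tendsto_atTop_zero).eventually (gt_mem_nhds (by linarith))
  obtain ⟨K₀, hK₀⟩ := eventually_atTop.mp hev
  obtain ⟨K, hK, t, ht, hfl⟩ := hfloor K₀
  have hdev := fibreDev_le_of_classLawTV (T K) (π K) (A K t) (B K t) (hA K t ht) (hB K t ht) (hZA K t ht) (hZB K t ht) (hρ K t ht)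
  have hsρ : s ≤ 2 * ρ K := le_of_mul_le_mul_right (hfl.trans hdev) (hZA K t ht)
  linarith [hK₀ K hK]

end Kill

/-! ## §2 At the record: the dial-free carriers `(classSet₁₃, weightA₁₃, weightB₁₃)` of EVERY `crOfRecord₁₃V (jc …) sh` — a floor at ANY key reading `kr` kills every dial -/

section Record

variable {F : T4Family} {N : ℕ} [NeZero N] (K₀ : ℕ) (kr : KeyReading₁₃ N K₀) (θ : Stage13HParams F N) (hP : θ.Provisos₁₃CoPH F N)
  (g₀ : ℕ → ℝ) (os : List (ULoop F)) (vol : ℝ)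

/-- **★★★ AN UNSUMMABLE run-A DEVIATION FLOOR AT ANY KEY READING KILLS EVERY DIAL AT THE RECORD's CARRIERS.**  At a tuple with core provisos: positive totals on
`|t| ≤ 1`, a key reading `kr`, a floor `d ≥ 0` with `Σ d_K = ∞` and `d_K·Σ weightA₁₃ < Dev_A(kr)(K, t_K)` at some `|t_K| ≤ 1` for every `K` ⇒ for EVERY volume letter `vol`
there are NO `Bad, W, shA, shB, Wsh, δ` with `HybridNE7 1 vol (classSet₁₃ …) (weightA₁₃ …) (weightB₁₃ …) Bad W shA shB Wsh δ` — in particular none of stub 2's dial values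
`(jc, sh)` with the canonical `(W, Wsh, δ)` of `crOfRecord₁₃V` (its carriers are these, dial-free: `crOfRecord₁₃VAt_T ∕ _A ∕ _B`).  The floor is a HYPOTHESIS — NOT PRINTED, NOT
measured. [bookkeeping] -/
theorem not_exists_hybridNE7_record_of_unsummable_fibreDevA
    (hZA : ∀ (K : ℕ) (t : ℝ), |t| ≤ 1 → 0 < ∑ x ∈ classSet₁₃ θ K₀ g₀ K, weightA₁₃ θ hP K₀ g₀ os K t x)
    (hZB : ∀ (K : ℕ) (t : ℝ), |t| ≤ 1 → 0 < ∑ x ∈ classSet₁₃ θ K₀ g₀ K, weightB₁₃ θ hP K₀ g₀ os K t x)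
    {d : ℕ → ℝ} (hd0 : ∀ K, 0 ≤ d K) (hds : ¬ Summable d)
    (hfloor : ∀ K, ∃ t, |t| ≤ 1 ∧ d K * ∑ x ∈ classSet₁₃ θ K₀ g₀ K, weightA₁₃ θ hP K₀ g₀ os K t x <
      ∑ x ∈ classSet₁₃ θ K₀ g₀ K, max 0 (weightA₁₃ θ hP K₀ g₀ os K t x -
        weightAK₁₃ θ hP K₀ g₀ os (kr F θ hP g₀ os) K t (kr F θ hP g₀ os K x) / weightBK₁₃ θ hP K₀ g₀ os (kr F θ hP g₀ os) K t (kr F θ hP g₀ os K x) *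
          weightB₁₃ θ hP K₀ g₀ os K t x)) :
    letI : ∀ Kc, DecidableEq (SiteSeqKey F Kc) := fun _ => Classical.decEq _
    ¬ ∃ (Bad : ℕ → ℝ → Finset (Σ K, SiteSeqKey F (K₀ + K))) (W : ℕ → ℝ) (shA shB : ℕ → ℝ → (Σ K, SiteSeqKey F (K₀ + K)) → ℝ) (Wsh δ : ℕ → ℝ),
      HybridNE7 1 vol (classSet₁₃ θ K₀ g₀) (weightA₁₃ θ hP K₀ g₀ os) (weightB₁₃ θ hP K₀ g₀ os) Bad W shA shB Wsh δ := by
  letI : ∀ Kc, DecidableEq (SiteSeqKey F Kc) := fun _ => Classical.decEq _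
  exact not_exists_hybridNE7_of_unsummable_fibreDev (π := kr F θ hP g₀ os) (fun K t _ x _ => weightA₁₃_nonneg F θ hP K₀ g₀ os K t x)
    (fun K t _ x _ => weightB₁₃_nonneg F θ hP K₀ g₀ os K t x) hZA hZB hd0 hds hfloor

/-- **★★★ … run B** (a run-B deviation floor `d_K·Σ weightB₁₃ < Dev_B(kr)(K, t_K)`; `HybridNE7` is stated with the runs in the record's order, so the kill goes through the
run-B class-law gap, `|·|` symmetric). [bookkeeping] -/
theorem not_exists_hybridNE7_record_of_unsummable_fibreDevB
    (hZA : ∀ (K : ℕ) (t : ℝ), |t| ≤ 1 → 0 < ∑ x ∈ classSet₁₃ θ K₀ g₀ K, weightA₁₃ θ hP K₀ g₀ os K t x)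
    (hZB : ∀ (K : ℕ) (t : ℝ), |t| ≤ 1 → 0 < ∑ x ∈ classSet₁₃ θ K₀ g₀ K, weightB₁₃ θ hP K₀ g₀ os K t x)
    {d : ℕ → ℝ} (hd0 : ∀ K, 0 ≤ d K) (hds : ¬ Summable d)
    (hfloor : ∀ K, ∃ t, |t| ≤ 1 ∧ d K * ∑ x ∈ classSet₁₃ θ K₀ g₀ K, weightB₁₃ θ hP K₀ g₀ os K t x <
      ∑ x ∈ classSet₁₃ θ K₀ g₀ K, max 0 (weightB₁₃ θ hP K₀ g₀ os K t x -
        weightBK₁₃ θ hP K₀ g₀ os (kr F θ hP g₀ os) K t (kr F θ hP g₀ os K x) / weightAK₁₃ θ hP K₀ g₀ os (kr F θ hP g₀ os) K t (kr F θ hP g₀ os K x) *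
          weightA₁₃ θ hP K₀ g₀ os K t x)) :
    letI : ∀ Kc, DecidableEq (SiteSeqKey F Kc) := fun _ => Classical.decEq _
    ¬ ∃ (Bad : ℕ → ℝ → Finset (Σ K, SiteSeqKey F (K₀ + K))) (W : ℕ → ℝ) (shA shB : ℕ → ℝ → (Σ K, SiteSeqKey F (K₀ + K)) → ℝ) (Wsh δ : ℕ → ℝ),
      HybridNE7 1 vol (classSet₁₃ θ K₀ g₀) (weightA₁₃ θ hP K₀ g₀ os) (weightB₁₃ θ hP K₀ g₀ os) Bad W shA shB Wsh δ := by
  letI : ∀ Kc, DecidableEq (SiteSeqKey F Kc) := fun _ => Classical.decEq _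
  rintro ⟨Bad, W, shA, shB, Wsh, δ, h⟩
  obtain ⟨ρ, hρ01, hρs, hρ⟩ := exists_tvRadius_of_hybridNE7 h hZA hZB
  refine hds (Summable.of_nonneg_of_le hd0 (fun K => ?_) (hρs.mul_left 2))
  obtain ⟨t, ht, hfl⟩ := hfloor K
  have hdev := fibreDev_le_of_classLawTV (classSet₁₃ θ K₀ g₀ K) (kr F θ hP g₀ os K) (weightB₁₃ θ hP K₀ g₀ os K t) (weightA₁₃ θ hP K₀ g₀ os K t)
    (fun x _ => weightB₁₃_nonneg F θ hP K₀ g₀ os K t x) (fun x _ => weightA₁₃_nonneg F θ hP K₀ g₀ os K t x) (hZB K t ht) (hZA K t ht)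
    (fun S' hS' => by rw [abs_sub_comm]; exact hρ K t ht S' hS')
  exact le_of_lt (lt_of_mul_lt_mul_right (hfl.trans_le hdev) (hZB K t ht).le)

/-- **★★ A FREQUENT PROPORTIONAL run-A DEVIATION FLOOR AT ANY KEY READING KILLS EVERY DIAL** — the `LawSeparated`-shaped hypothesis in mass: `0 < s` and, cofinally in `K`,
`s·Σ weightA₁₃ ≤ Dev_A(kr)(K, t)` at some `|t| ≤ 1`. [bookkeeping] -/
theorem not_exists_hybridNE7_record_of_frequently_fibreDevA_ge
    (hZA : ∀ (K : ℕ) (t : ℝ), |t| ≤ 1 → 0 < ∑ x ∈ classSet₁₃ θ K₀ g₀ K, weightA₁₃ θ hP K₀ g₀ os K t x)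
    (hZB : ∀ (K : ℕ) (t : ℝ), |t| ≤ 1 → 0 < ∑ x ∈ classSet₁₃ θ K₀ g₀ K, weightB₁₃ θ hP K₀ g₀ os K t x)
    {s : ℝ} (hs : 0 < s)
    (hfloor : ∀ K₁, ∃ K, K₁ ≤ K ∧ ∃ t, |t| ≤ 1 ∧ s * ∑ x ∈ classSet₁₃ θ K₀ g₀ K, weightA₁₃ θ hP K₀ g₀ os K t x ≤
      ∑ x ∈ classSet₁₃ θ K₀ g₀ K, max 0 (weightA₁₃ θ hP K₀ g₀ os K t x -
        weightAK₁₃ θ hP K₀ g₀ os (kr F θ hP g₀ os) K t (kr F θ hP g₀ os K x) / weightBK₁₃ θ hP K₀ g₀ os (kr F θ hP g₀ os) K t (kr F θ hP g₀ os K x) *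
          weightB₁₃ θ hP K₀ g₀ os K t x)) :
    letI : ∀ Kc, DecidableEq (SiteSeqKey F Kc) := fun _ => Classical.decEq _
    ¬ ∃ (Bad : ℕ → ℝ → Finset (Σ K, SiteSeqKey F (K₀ + K))) (W : ℕ → ℝ) (shA shB : ℕ → ℝ → (Σ K, SiteSeqKey F (K₀ + K)) → ℝ) (Wsh δ : ℕ → ℝ),
      HybridNE7 1 vol (classSet₁₃ θ K₀ g₀) (weightA₁₃ θ hP K₀ g₀ os) (weightB₁₃ θ hP K₀ g₀ os) Bad W shA shB Wsh δ := by
  letI : ∀ Kc, DecidableEq (SiteSeqKey F Kc) := fun _ => Classical.decEq _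
  exact not_exists_hybridNE7_of_frequently_fibreDev_ge (π := kr F θ hP g₀ os) (fun K t _ x _ => weightA₁₃_nonneg F θ hP K₀ g₀ os K t x)
    (fun K t _ x _ => weightB₁₃_nonneg F θ hP K₀ g₀ os K t x) hZA hZB hs hfloor

end Record

/-! ## §3 (v1.1, APPEND-ONLY) On the live-selector line: the positivity rows discharged (E1 ∕ E2 + `schemeZ_pos`), the kills from «live line + floor» alone -/

section Live

open Summit.QuantumFields.YangMills.BalabanUVNodes.N20KeyedRelWeightFraction (sum_classSet₁₃_weightA_pos_of_sel sum_classSet₁₃_weightB_pos_of_sel)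

variable {F : T4Family} {N : ℕ} [NeZero N] (K₀ : ℕ) (kr : KeyReading₁₃ N K₀) (θ : Stage13HParams F N) (hP : θ.Provisos₁₃CoPH F N)
  (g₀ : ℕ → ℝ) (os : List (ULoop F)) (vol : ℝ) (E : B12.RunParams → ℝ)
  /- the live-selector pin and the two measurability laws under which dag-n20-d's E1 ∕ E2 dictionary holds (K3's `LiveSel` ∕ (H-U) ∕ (H-ζ) rows) -/
  (hsel : θ.ppSel = ppSelLiveOfRecord F N θ.ν θ.τ9 E (wOfRecord₉ F N θ.toStage9Params)) (hU : LocalBgMeasurable F N θ.ν) (hζm : ZetaMeasurable F N θ.ζ)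

include hsel hU hζm in
/-- **★★★ ON THE LIVE LINE, AN UNSUMMABLE run-A DEVIATION FLOOR AT ANY KEY READING KILLS EVERY DIAL** — §2's `not_exists_hybridNE7_record_of_unsummable_fibreDevA` with its two
positivity rows DISCHARGED: on the live-selector line (`hsel`, (H-U), (H-ζ)) the run-A ∕ run-B keyed totals ARE the dressed partition functions `Z_{K₀+K}(t)` ∕ `Z_{K₀+K+1}(t)` of the
datum of record (dag-n20-d's E1 ∕ E2), positive by `schemeZ_pos` (dag-n20-w2's `sum_classSet₁₃_weightA∕B_pos_of_sel`, p600586).  Remaining hypothesis: the floor (NOT PRINTED, NOT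
measured). [bookkeeping] -/
theorem not_exists_hybridNE7_record_of_unsummable_fibreDevA_liveSel {d : ℕ → ℝ} (hd0 : ∀ K, 0 ≤ d K) (hds : ¬ Summable d)
    (hfloor : ∀ K, ∃ t, |t| ≤ 1 ∧ d K * ∑ x ∈ classSet₁₃ θ K₀ g₀ K, weightA₁₃ θ hP K₀ g₀ os K t x <
      ∑ x ∈ classSet₁₃ θ K₀ g₀ K, max 0 (weightA₁₃ θ hP K₀ g₀ os K t x -
        weightAK₁₃ θ hP K₀ g₀ os (kr F θ hP g₀ os) K t (kr F θ hP g₀ os K x) / weightBK₁₃ θ hP K₀ g₀ os (kr F θ hP g₀ os) K t (kr F θ hP g₀ os K x) *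
          weightB₁₃ θ hP K₀ g₀ os K t x)) :
    letI : ∀ Kc, DecidableEq (SiteSeqKey F Kc) := fun _ => Classical.decEq _
    ¬ ∃ (Bad : ℕ → ℝ → Finset (Σ K, SiteSeqKey F (K₀ + K))) (W : ℕ → ℝ) (shA shB : ℕ → ℝ → (Σ K, SiteSeqKey F (K₀ + K)) → ℝ) (Wsh δ : ℕ → ℝ),
      HybridNE7 1 vol (classSet₁₃ θ K₀ g₀) (weightA₁₃ θ hP K₀ g₀ os) (weightB₁₃ θ hP K₀ g₀ os) Bad W shA shB Wsh δ :=
  not_exists_hybridNE7_record_of_unsummable_fibreDevA K₀ kr θ hP g₀ os vol (fun K t _ => sum_classSet₁₃_weightA_pos_of_sel θ hP K₀ g₀ os E hsel hU hζm K t)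
    (fun K t _ => sum_classSet₁₃_weightB_pos_of_sel θ hP K₀ g₀ os E hsel hU hζm K t) hd0 hds hfloor

include hsel hU hζm in
/-- **★★★ … run B, on the live line.** [bookkeeping] -/
theorem not_exists_hybridNE7_record_of_unsummable_fibreDevB_liveSel {d : ℕ → ℝ} (hd0 : ∀ K, 0 ≤ d K) (hds : ¬ Summable d)
    (hfloor : ∀ K, ∃ t, |t| ≤ 1 ∧ d K * ∑ x ∈ classSet₁₃ θ K₀ g₀ K, weightB₁₃ θ hP K₀ g₀ os K t x <
      ∑ x ∈ classSet₁₃ θ K₀ g₀ K, max 0 (weightB₁₃ θ hP K₀ g₀ os K t x -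
        weightBK₁₃ θ hP K₀ g₀ os (kr F θ hP g₀ os) K t (kr F θ hP g₀ os K x) / weightAK₁₃ θ hP K₀ g₀ os (kr F θ hP g₀ os) K t (kr F θ hP g₀ os K x) *
          weightA₁₃ θ hP K₀ g₀ os K t x)) :
    letI : ∀ Kc, DecidableEq (SiteSeqKey F Kc) := fun _ => Classical.decEq _
    ¬ ∃ (Bad : ℕ → ℝ → Finset (Σ K, SiteSeqKey F (K₀ + K))) (W : ℕ → ℝ) (shA shB : ℕ → ℝ → (Σ K, SiteSeqKey F (K₀ + K)) → ℝ) (Wsh δ : ℕ → ℝ),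
      HybridNE7 1 vol (classSet₁₃ θ K₀ g₀) (weightA₁₃ θ hP K₀ g₀ os) (weightB₁₃ θ hP K₀ g₀ os) Bad W shA shB Wsh δ :=
  not_exists_hybridNE7_record_of_unsummable_fibreDevB K₀ kr θ hP g₀ os vol (fun K t _ => sum_classSet₁₃_weightA_pos_of_sel θ hP K₀ g₀ os E hsel hU hζm K t)
    (fun K t _ => sum_classSet₁₃_weightB_pos_of_sel θ hP K₀ g₀ os E hsel hU hζm K t) hd0 hds hfloor

include hsel hU hζm in
/-- **★★ … and the frequent proportional run-A floor, on the live line** (the `LawSeparated` quantifier shape in mass). [bookkeeping] -/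
theorem not_exists_hybridNE7_record_of_frequently_fibreDevA_ge_liveSel {s : ℝ} (hs : 0 < s)
    (hfloor : ∀ K₁, ∃ K, K₁ ≤ K ∧ ∃ t, |t| ≤ 1 ∧ s * ∑ x ∈ classSet₁₃ θ K₀ g₀ K, weightA₁₃ θ hP K₀ g₀ os K t x ≤
      ∑ x ∈ classSet₁₃ θ K₀ g₀ K, max 0 (weightA₁₃ θ hP K₀ g₀ os K t x -
        weightAK₁₃ θ hP K₀ g₀ os (kr F θ hP g₀ os) K t (kr F θ hP g₀ os K x) / weightBK₁₃ θ hP K₀ g₀ os (kr F θ hP g₀ os) K t (kr F θ hP g₀ os K x) *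
          weightB₁₃ θ hP K₀ g₀ os K t x)) :
    letI : ∀ Kc, DecidableEq (SiteSeqKey F Kc) := fun _ => Classical.decEq _
    ¬ ∃ (Bad : ℕ → ℝ → Finset (Σ K, SiteSeqKey F (K₀ + K))) (W : ℕ → ℝ) (shA shB : ℕ → ℝ → (Σ K, SiteSeqKey F (K₀ + K)) → ℝ) (Wsh δ : ℕ → ℝ),
      HybridNE7 1 vol (classSet₁₃ θ K₀ g₀) (weightA₁₃ θ hP K₀ g₀ os) (weightB₁₃ θ hP K₀ g₀ os) Bad W shA shB Wsh δ :=
  not_exists_hybridNE7_record_of_frequently_fibreDevA_ge K₀ kr θ hP g₀ os vol (fun K t _ => sum_classSet₁₃_weightA_pos_of_sel θ hP K₀ g₀ os E hsel hU hζm K t)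
    (fun K t _ => sum_classSet₁₃_weightB_pos_of_sel θ hP K₀ g₀ os E hsel hU hζm K t) hs hfloor

end Live

end Summit.QuantumFields.YangMills.BalabanUVNodes.N20CoreEdgeShellDialDeviationKill

end
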